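import Mathlib
import Summits.Ventures.PercRepro2.ThreeTermPartHarris

/-!
# Three-terminal parts, V a: typed Harris on EVERY pair of up-sets, and the join of patterns
(blind cell PercRepro2, night-3 g31, 2026-08-30; `proofs/NIGHT3-CERT.md` §40)

The typed Harris condition `TypedHarris πpat n` (ThreeTermPatternCone.lean) is stated through the nine
generators `s : Fin 9` — the nine INCOMPARABLE pairs `(U_S, U_S′)` of up-sets of the partition lattice of
three terminals (`0 = ⊥`, `1 = 01`, `2 = 02`, `3 = 12`, `4 = ⊤`).  For the join closure of the cone
(ThreeTermJoinClosure.lean) the same inequality is needed for EVERY pair of up-sets `(U₁, U₂)`: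

  `Σ_{b c} n a b c · [π b ∈ U₁] · [π c ∈ U₂] ≤ Σ_{b c} n a b c · [π b ∈ U₁] · [π b ∈ U₂]`

— for comparable pairs it follows from `n ≥ 0` and the copy symmetry of `n`, for incomparable pairs
it IS a generator (either way round).  This file lists the ten up-sets (`up5`), proves the trichotomy
by one kernel `decide` (`up5_pairs`), and derives **`typedHarris_pairs`**.

It also defines the JOIN of two patterns (`orP`, the bitwise «or» of the three observables) and
proves the two facts the closure needs: the join of two `patOf` patterns is the `patOf` of the joined
bits (`orP_patOf`), and the event `{b | π (b ⊔ p) ∈ U}` is again an up-set event `{b | π b ∈ U′}`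
(`up5_orP`, one kernel `decide`) — the join with a fixed partition is monotone on the lattice.

Own work; standard axioms.
-/

namespace Summit.Ventures.PercRepro2

open Block ThreeTerm TypedStar

namespace Part

/-! ## The ten up-sets of the partition lattice and the generator pairs -/

section Upsets

/-- The ten up-sets of the partition lattice of three terminals: `∅`, `{⊤}`, `U_1`, `U_2`, `U_3`,
`U_12`, `U_13`, `U_23`, `U_123`, everything. -/
def up5 (u : Fin 10) (p : Fin 5) : Bool :=
  match u with
  | 0 => false
  | 1 => p = 4
  | 2 => p = 1 || p = 4
  | 3 => p = 2 || p = 4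
  | 4 => p = 3 || p = 4
  | 5 => p = 1 || p = 2 || p = 4
  | 6 => p = 1 || p = 3 || p = 4
  | 7 => p = 2 || p = 3 || p = 4
  | 8 => p = 1 || p = 2 || p = 3 || p = 4
  | 9 => true

/-- Every left up-set of a generator is one of the ten. -/
lemma uL_eq_up5 : ∀ s : Fin 9, ∃ u : Fin 10, ∀ p : Fin 5, uL s p = up5 u p := by decide

/-- Every right up-set of a generator is one of the ten. -/
lemma uR_eq_up5 : ∀ s : Fin 9, ∃ u : Fin 10, ∀ p : Fin 5, uR s p = up5 u p := by decide

/-- **The trichotomy of up-set pairs**: two up-sets are comparable, or they are the two up-sets of one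
of the nine generators (either way round). -/
lemma up5_pairs : ∀ u₁ u₂ : Fin 10,
    (∀ p : Fin 5, up5 u₁ p = true → up5 u₂ p = true) ∨
    (∀ p : Fin 5, up5 u₂ p = true → up5 u₁ p = true) ∨
    ∃ s : Fin 9, ((∀ p : Fin 5, uL s p = up5 u₁ p) ∧ ∀ p : Fin 5, uR s p = up5 u₂ p) ∨
                 ((∀ p : Fin 5, uL s p = up5 u₂ p) ∧ ∀ p : Fin 5, uR s p = up5 u₁ p) := by
  decide

end Upsets

/-! ## The join of two patterns -/

section Join

/-- Bit `0` of a pattern (`t₁ ↔ t₂`). -/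
def bit0 (a : Fin 8) : Bool := a.val % 2 = 1

/-- Bit `1` of a pattern (`t₁ ↔ t₃`). -/
def bit1 (a : Fin 8) : Bool := (a.val / 2) % 2 = 1

/-- Bit `2` of a pattern (`t₂ ↔ t₃`). -/
def bit2 (a : Fin 8) : Bool := a.val / 4 = 1

/-- **The join of two patterns**: the bitwise «or» of the three observables. -/
def orP (a b : Fin 8) : Fin 8 := patOf (bit0 a || bit0 b) (bit1 a || bit1 b) (bit2 a || bit2 b)

/-- Every pattern is `patOf` of its three bits. -/
lemma patOf_bits : ∀ a : Fin 8, patOf (bit0 a) (bit1 a) (bit2 a) = a := by decide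

/-- The join of two `patOf` patterns is the `patOf` of the joined bits. -/
lemma orP_patOf : ∀ b0 b1 b2 c0 c1 c2 : Bool,
    orP (patOf b0 b1 b2) (patOf c0 c1 c2) = patOf (b0 || c0) (b1 || c1) (b2 || c2) := by
  decide

/-- The join is commutative. -/
lemma orP_comm : ∀ a b : Fin 8, orP a b = orP b a := by decide

/-- The join with `⊥` is the identity. -/
lemma orP_zero : ∀ a : Fin 8, orP a 0 = a := by decide

/-- The join is associative. -/
lemma orP_assoc : ∀ a b c : Fin 8, orP (orP a b) c = orP a (orP b c) := by decide

/-- **The join with a fixed pattern preserves up-set events**: for every up-set `u` and pattern `p`,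
`{b | up5 u (πpat (b ⊔ p))}` is the up-set event of some `u′`. -/
lemma up5_orP : ∀ (u : Fin 10) (p : Fin 8), ∃ u' : Fin 10,
    ∀ b : Fin 8, up5 u (πpat (orP b p)) = up5 u' (πpat b) := by
  decide

end Join

/-! ## Typed Harris on every pair of up-sets -/

section Pairs

/-- The indicator of an up-set event. -/
def ind5 (u : Fin 10) (p : Fin 5) : ℚ := if up5 u p then 1 else 0

/-- The indicator is at most one. -/
lemma ind5_le_one (u : Fin 10) (p : Fin 5) : ind5 u p ≤ 1 := by
  unfold ind5; split_ifs <;> norm_num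

/-- The indicator is nonnegative. -/
lemma ind5_nonneg (u : Fin 10) (p : Fin 5) : 0 ≤ ind5 u p := by
  unfold ind5; split_ifs <;> norm_num

/-- Swapping copies 2 and 3 under a double sum against a copy-symmetric `n`. -/
lemma sum_swap23 {n : Fin 8 → Fin 8 → Fin 8 → ℚ} (hn : Sym3 n) (a : Fin 8) (f : Fin 8 → Fin 8 → ℚ) :
    (∑ b : Fin 8, ∑ c : Fin 8, n a b c * f b c) = ∑ b : Fin 8, ∑ c : Fin 8, n a b c * f c b := by
  rw [Finset.sum_comm]
  refine Finset.sum_congr rfl fun b _ => Finset.sum_congr rfl fun c _ => ?_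
  rw [hn.swap23 a c b]

/-- The generator inequality with the unsymmetrised slack `hh`, for an abstract copy-symmetric law. -/
lemma typedHarris_hh {n : Fin 8 → Fin 8 → Fin 8 → ℚ} (hn : Sym3 n) (hH : TypedHarris πpat n)
    (a : Fin 8) (s : Fin 9) :
    0 ≤ ∑ b : Fin 8, ∑ c : Fin 8, n a b c * hh s (πpat b) (πpat c) := by
  have h := hH a s
  have e : (∑ b : Fin 8, ∑ c : Fin 8, hq s (πpat b) (πpat c) * n a b c) =
      ∑ b : Fin 8, ∑ c : Fin 8, n a b c * hh s (πpat b) (πpat c) := by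
    have h2 : ∀ b c : Fin 8, hq s (πpat b) (πpat c) * n a b c =
        (n a b c * hh s (πpat b) (πpat c) + n a b c * hh s (πpat c) (πpat b)) / 2 := by
      intro b c
      rw [hq_eq_hh]
      ring
    simp only [h2, Finset.sum_add_distrib, ← Finset.sum_div]
    rw [sum_swap23 hn a (fun b c => hh s (πpat c) (πpat b))]
    ring
  rwa [e] at h

/-- The unsymmetrised slack as a difference of indicator products. -/
lemma hh_eq_ind (s : Fin 9) (u₁ u₂ : Fin 10) (hL : ∀ p : Fin 5, uL s p = up5 u₁ p)
    (hR : ∀ p : Fin 5, uR s p = up5 u₂ p) (p q : Fin 5) :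
    hh s p q = ind5 u₁ p * ind5 u₂ p - ind5 u₁ p * ind5 u₂ q := by
  simp only [hh, ind5, hL, hR]
  ring

/-- **TYPED HARRIS ON EVERY PAIR OF UP-SETS**: for a copy-symmetric nonnegative law satisfying the
typed Harris condition, and ANY two up-sets `u₁`, `u₂` of the partition lattice,
`Σ_{b c} n a b c · [π b ∈ U₁] · [π c ∈ U₂] ≤ Σ_{b c} n a b c · [π b ∈ U₁] · [π b ∈ U₂]`. -/
theorem typedHarris_pairs {n : Fin 8 → Fin 8 → Fin 8 → ℚ} (hn : Sym3 n) (hn0 : ∀ i j k, 0 ≤ n i j k)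
    (hH : TypedHarris πpat n) (a : Fin 8) (u₁ u₂ : Fin 10) :
    (∑ b : Fin 8, ∑ c : Fin 8, n a b c * (ind5 u₁ (πpat b) * ind5 u₂ (πpat c))) ≤
      ∑ b : Fin 8, ∑ c : Fin 8, n a b c * (ind5 u₁ (πpat b) * ind5 u₂ (πpat b)) := by
  rcases up5_pairs u₁ u₂ with h | h | ⟨s, ⟨hL, hR⟩ | ⟨hL, hR⟩⟩
  · -- u₁ ⊆ u₂: termwise
    refine Finset.sum_le_sum fun b _ => Finset.sum_le_sum fun c _ => ?_
    refine mul_le_mul_of_nonneg_left ?_ (hn0 a b c)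
    by_cases hb : up5 u₁ (πpat b) = true
    · have hb2 := h _ hb
      simp only [ind5, hb, hb2, if_true, one_mul]
      split_ifs <;> norm_num
    · simp [ind5, hb]
  · -- u₂ ⊆ u₁: drop the first factor, then swap the copies
    calc (∑ b : Fin 8, ∑ c : Fin 8, n a b c * (ind5 u₁ (πpat b) * ind5 u₂ (πpat c)))
        ≤ ∑ b : Fin 8, ∑ c : Fin 8, n a b c * ind5 u₂ (πpat c) := by
          refine Finset.sum_le_sum fun b _ => Finset.sum_le_sum fun c _ => ?_
          refine mul_le_mul_of_nonneg_left ?_ (hn0 a b c)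
          calc ind5 u₁ (πpat b) * ind5 u₂ (πpat c) ≤ 1 * ind5 u₂ (πpat c) :=
                mul_le_mul_of_nonneg_right (ind5_le_one _ _) (ind5_nonneg _ _)
            _ = ind5 u₂ (πpat c) := one_mul _
      _ = ∑ b : Fin 8, ∑ c : Fin 8, n a b c * ind5 u₂ (πpat b) :=
          sum_swap23 hn a (fun _ c => ind5 u₂ (πpat c))
      _ = ∑ b : Fin 8, ∑ c : Fin 8, n a b c * (ind5 u₁ (πpat b) * ind5 u₂ (πpat b)) := by
          refine Finset.sum_congr rfl fun b _ => Finset.sum_congr rfl fun c _ => ?_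
          congr 1
          by_cases hb : up5 u₂ (πpat b) = true
          · have hb1 := h _ hb
            simp [ind5, hb, hb1]
          · simp [ind5, hb]
  · -- a generator, the right way round
    have key := typedHarris_hh hn hH a s
    simp only [hh_eq_ind s u₁ u₂ hL hR, mul_sub, Finset.sum_sub_distrib] at key
    exact sub_nonneg.1 key
  · -- a generator, the other way round: swap the copies
    have key := typedHarris_hh hn hH a s
    simp only [hh_eq_ind s u₂ u₁ hL hR, mul_sub, Finset.sum_sub_distrib] at key
    have key' := sub_nonneg.1 key
    calc (∑ b : Fin 8, ∑ c : Fin 8, n a b c * (ind5 u₁ (πpat b) * ind5 u₂ (πpat c)))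
        = ∑ b : Fin 8, ∑ c : Fin 8, n a b c * (ind5 u₂ (πpat b) * ind5 u₁ (πpat c)) := by
          rw [sum_swap23 hn a (fun b c => ind5 u₁ (πpat b) * ind5 u₂ (πpat c))]
          refine Finset.sum_congr rfl fun b _ => Finset.sum_congr rfl fun c _ => ?_
          ring
      _ ≤ ∑ b : Fin 8, ∑ c : Fin 8, n a b c * (ind5 u₂ (πpat b) * ind5 u₁ (πpat b)) := key'
      _ = ∑ b : Fin 8, ∑ c : Fin 8, n a b c * (ind5 u₁ (πpat b) * ind5 u₂ (πpat b)) := by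
          refine Finset.sum_congr rfl fun b _ => Finset.sum_congr rfl fun c _ => ?_
          ring

end Pairs

end Part

end Summit.Ventures.PercRepro2
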